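import Mathlib
import Literature.NumberTheory.GaloisRepresentations.FrobeniusDensityTheorem
import Literature.NumberTheory.GaloisRepresentations.ArtinLemma
import Literature.NumberTheory.GaloisRepresentations.CyclotomicFrobenius
import HarnessLib

/-!
# Power residues and splitting in subfields of cyclotomic fields (Kummer's criterion)

Topic `NumberTheory/NumberFields`.  Theorem-only file (no definition, no named fact, D-0026),
unconditional.  Let `N = ℚ(ζ_n)` and, for `d ∈ ℕ`, let `C_d ⊆ N` be the fixed field of the
subgroup of `d`-th powers of `Gal(N/ℚ) ≅ (ℤ/n)ˣ` (for `n = ℓ` prime and `d ∣ ℓ − 1` this is the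
unique subfield of degree `d`; `d = 3`, `ℓ ≡ 1 (mod 3)`: the cubic field `k(ℓ)` of genus theory).
For a rational prime `q ∤ n`:

> **`q` splits completely in `C_d` iff `q` is a `d`-th power residue modulo `n`**
> (Kummer; Marcus, *Number Fields*, Ch. 4 Thm. 32 ff. and Ex. 12: the primes splitting completely
> in the subfield of `ℚ(ζ_n)` fixed by `H ≤ (ℤ/n)ˣ` are those with `q mod n ∈ H`; Washington,
> *Cyclotomic Fields*, Thm. 2.13 for `ℚ(ζ_n)` itself).

Proof: `q` is unramified in `N` (`ArtinLemma.isUnramifiedAt_of_isCyclotomicExtension`); by the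
decomposition-field dictionary (`mem_splitPrimes_intermediateField_iff`) `q` splits completely in
the fixed field of `H` iff its Frobenius lies in `H`; and the Frobenius of `q` is `q mod n` under
`Gal(N/ℚ) ≅ (ℤ/n)ˣ` (`ArtinLemma.val_autToPow_of_isArithFrobAt`).

* `Literature.NumberTheory.NumberFields.mem_splitPrimes_fixedField_powers_iff` — the criterion
  for any `n` and `d`;
* `Literature.NumberTheory.NumberFields.finrank_fixedField_powers` — `[C_d : ℚ] = gcd(ℓ − 1, d)`
  for `n = ℓ` prime (so `= 3` for `d = 3`, `ℓ ≡ 1 (mod 3)`: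
  `finrank_fixedField_cubes_eq_three`);
* `Literature.NumberTheory.NumberFields.mem_splitPrimes_fixedField_cubes_iff` — **`q` splits
  completely in the cubic subfield `k(ℓ)` of `ℚ(ζ_ℓ)` iff `q` is a cubic residue mod `ℓ`.**

This is the decomposition law needed to identify the class-field-theoretic genus characters of
`ℚ(∛m)` (`PureCubicGenusRank.lean`) with the rational ones (`PureCubicRationalGenus.lean`).

## References

* D. A. Marcus, *Number Fields*, 2nd ed. (2018), Ch. 4, Thm. 32 and Exercise 12. [Marcus2018]
* L. C. Washington, *Introduction to Cyclotomic Fields*, 2nd ed. (1997), Thm. 2.13. [Washington1997]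
-/

noncomputable section

open NumberField IsDedekindDomain

namespace Literature.NumberTheory.NumberFields

open Literature.NumberTheory.GaloisRepresentations

/-- **Kummer's criterion.**  Let `N = ℚ(ζ_n)`, `H_d ≤ Gal(N/ℚ)` the preimage of the `d`-th powers
under `Gal(N/ℚ) ≅ (ℤ/n)ˣ`, and `q ∤ n` a rational prime (a nonzero prime `v` of `𝓞 ℚ` not
containing `n`).  Then `v` splits completely in the fixed field of `H_d` iff `N v = q` is a `d`-th
power in `(ℤ/n)ˣ`. [cite: Marcus2018, Ch. 4 Thm. 32 and Ex. 12] -/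
theorem mem_splitPrimes_fixedField_powers_iff {n : ℕ} [NeZero n] (N : Type*) [Field N]
    [NumberField N] [IsCyclotomicExtension {n} ℚ N] (d : ℕ)
    (v : HeightOneSpectrum (𝓞 ℚ)) (hv : (n : 𝓞 ℚ) ∉ v.asIdeal) :
    v ∈ splitPrimes ℚ (IntermediateField.fixedField
        (((powMonoidHom d : (ZMod n)ˣ →* (ZMod n)ˣ).range).comap
          (IsCyclotomicExtension.Rat.galEquivZMod n N).toMonoidHom)) ↔
      ∃ u : (ZMod n)ˣ, (u : ZMod n) ^ d = (Ideal.absNorm v.asIdeal : ZMod n) := by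
  classical
  haveI : IsGalois ℚ N := IsCyclotomicExtension.isGalois {n} ℚ N
  set H : Subgroup (N ≃ₐ[ℚ] N) := ((powMonoidHom d : (ZMod n)ˣ →* (ZMod n)ˣ).range).comap
    (IsCyclotomicExtension.Rat.galEquivZMod n N).toMonoidHom with hH
  set C : IntermediateField ℚ N := IntermediateField.fixedField H with hC
  -- `v` is unramified in `N` and in `C`
  have hunrN : Algebra.IsUnramifiedIn (𝓞 N) v.asIdeal := by
    intro Q hQ hover
    have hnQ : (n : 𝓞 N) ∉ Q := fun h => hv (by
      rw [hover.over, Ideal.under_def, Ideal.mem_comap, map_natCast]; exact h)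
    exact ArtinLemma.isUnramifiedAt_of_isCyclotomicExtension (L := ℚ) Q hnQ
  have hunrC : Algebra.IsUnramifiedIn (𝓞 C) v.asIdeal :=
    ArtinLemma.isUnramifiedIn_intermediateField C hunrN
  -- a Frobenius `φ` at a prime `Q ∣ v`
  obtain ⟨Q, φ, hQ, hφ⟩ := exists_primesOver_isArithFrobAt ℚ N v
  -- (the two `ℚ`-algebra structures on `↥C` agree definitionally; restate in the ambient form)
  have key : v ∈ splitPrimes ℚ C ↔ φ ∈ C.fixingSubgroup :=
    mem_splitPrimes_intermediateField_iff C hunrN hunrC hQ hφ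
  rw [key, hC, IntermediateField.fixingSubgroup_fixedField, hH, Subgroup.mem_comap,
    MulEquiv.coe_toMonoidHom, MonoidHom.mem_range]
  -- the cyclotomic character of `φ` is `N v mod n`
  have hζ := IsCyclotomicExtension.zeta_spec n ℚ N
  have hval : ((IsCyclotomicExtension.Rat.galEquivZMod n N φ : (ZMod n)ˣ) : ZMod n) =
      (Ideal.absNorm v.asIdeal : ZMod n) := by
    have h := ArtinLemma.val_autToPow_of_isArithFrobAt (F := ℚ) hζ hv hQ hφ
    rw [← h]
    rfl
  constructor
  · rintro ⟨u, hu⟩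
    refine ⟨u, ?_⟩
    rw [← hval, ← hu, powMonoidHom_apply, Units.val_pow_eq_pow_val]
  · rintro ⟨u, hu⟩
    refine ⟨u, Units.ext ?_⟩
    rw [powMonoidHom_apply, Units.val_pow_eq_pow_val, hu, hval]

/-- For `n = ℓ` prime the fixed field of the `d`-th powers has degree `gcd(ℓ − 1, d)` over `ℚ`.
[cite: Marcus2018, Ch. 4 Ex. 12] -/
theorem finrank_fixedField_powers {ℓ : ℕ} [hℓ : Fact ℓ.Prime] (N : Type*) [Field N]
    [NumberField N] [IsCyclotomicExtension {ℓ} ℚ N] (d : ℕ) :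
    Module.finrank ℚ (IntermediateField.fixedField
        (((powMonoidHom d : (ZMod ℓ)ˣ →* (ZMod ℓ)ˣ).range).comap
          (IsCyclotomicExtension.Rat.galEquivZMod ℓ N).toMonoidHom)) = (ℓ - 1).gcd d := by
  classical
  haveI : IsGalois ℚ N := IsCyclotomicExtension.isGalois {ℓ} ℚ N
  have hsurj : Function.Surjective (IsCyclotomicExtension.Rat.galEquivZMod ℓ N).toMonoidHom :=
    (IsCyclotomicExtension.Rat.galEquivZMod ℓ N).surjective
  rw [IntermediateField.finrank_eq_fixingSubgroup_index, IntermediateField.fixingSubgroup_fixedField,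
    Subgroup.index_comap_of_surjective _ hsurj,
    IsCyclic.index_powMonoidHom_range, Nat.card_eq_fintype_card, ZMod.card_units_eq_totient,
    Nat.totient_prime hℓ.out]

/-- The cubic subfield: for `ℓ ≡ 1 (mod 3)` the fixed field of the cubes in `Gal(ℚ(ζ_ℓ)/ℚ)` has
degree `3`. [folklore] -/
theorem finrank_fixedField_cubes_eq_three {ℓ : ℕ} [hℓ : Fact ℓ.Prime] (hℓ1 : ℓ % 3 = 1)
    (N : Type*) [Field N] [NumberField N] [IsCyclotomicExtension {ℓ} ℚ N] :
    Module.finrank ℚ (IntermediateField.fixedField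
        (((powMonoidHom 3 : (ZMod ℓ)ˣ →* (ZMod ℓ)ˣ).range).comap
          (IsCyclotomicExtension.Rat.galEquivZMod ℓ N).toMonoidHom)) = 3 := by
  rw [finrank_fixedField_powers N 3]
  have h3 : 3 ∣ ℓ - 1 := by have := hℓ.out.two_le; omega
  exact Nat.gcd_eq_right h3

/-- **Cubic residues and the cubic subfield of `ℚ(ζ_ℓ)`** (`ℓ ≡ 1 (mod 3)`): a rational prime
`q ≠ ℓ` splits completely in the cubic field `k(ℓ) ⊆ ℚ(ζ_ℓ)` iff `q` is a cubic residue modulo `ℓ`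
(Gauss; Kummer).  This is the decomposition law behind the rational genus characters of `ℚ(∛m)`.
[cite: Marcus2018, Ch. 4 Thm. 32 and Ex. 12] -/
theorem mem_splitPrimes_fixedField_cubes_iff {ℓ : ℕ} [Fact ℓ.Prime] (N : Type*) [Field N]
    [NumberField N] [IsCyclotomicExtension {ℓ} ℚ N]
    (v : HeightOneSpectrum (𝓞 ℚ)) (hv : (ℓ : 𝓞 ℚ) ∉ v.asIdeal) :
    v ∈ splitPrimes ℚ (IntermediateField.fixedField
        (((powMonoidHom 3 : (ZMod ℓ)ˣ →* (ZMod ℓ)ˣ).range).comap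
          (IsCyclotomicExtension.Rat.galEquivZMod ℓ N).toMonoidHom)) ↔
      ∃ u : (ZMod ℓ)ˣ, (u : ZMod ℓ) ^ 3 = (Ideal.absNorm v.asIdeal : ZMod ℓ) :=
  mem_splitPrimes_fixedField_powers_iff N 3 v hv

end Literature.NumberTheory.NumberFields

end
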